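import Literature.MathematicalPhysics.QuantumFieldTheory.Balaban1983to89.B8Prop3MultiLevelTorusEtaL0
import Literature.MathematicalPhysics.QuantumFieldTheory.Balaban1983to89.B6Dg288ChartV1L0
import Literature.MathematicalPhysics.QuantumFieldTheory.Balaban1983to89.B8Eq12HodgeLaplacianV1
import Literature.MathematicalPhysics.QuantumFieldTheory.Balaban1983to89.B6Geom246MultiLevelBoxL0
import Literature.MathematicalPhysics.QuantumFieldTheory.Balaban1983to89.B6Geom246MultiLevelTorusL0
import Literature.MathematicalPhysics.QuantumFieldTheory.Balaban1983to89.B6GlobalChartV1L0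
import Literature.MathematicalPhysics.QuantumFieldTheory.Balaban1983to89.B6MultiLevelBoxOperatorL0
import Literature.MathematicalPhysics.QuantumFieldTheory.Balaban1983to89.B6MultiLevelTorusOperatorL0
import Literature.MathematicalPhysics.QuantumFieldTheory.Balaban1983to89.B6Prop26KLevelSkeletonV1L0
import Literature.MathematicalPhysics.QuantumFieldTheory.Balaban1983to89.B8Ineq159MultiLevelTorusL0
import Literature.MathematicalPhysics.QuantumFieldTheory.Balaban1983to89.B8Ineq192MultiLevelTorusL0
import Literature.MathematicalPhysics.QuantumFieldTheory.Balaban1983to89.B8Ineq198MultiLevelTorusL0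
import Literature.MathematicalPhysics.QuantumFieldTheory.Balaban1983to89.B8Prop3MultiLevelTorusLap

/-!
# `Balaban1983to89.B8Prop3MultiLevelTorusLapL0` — LEVEL-0 TWIN (programme G-F3′-L0, director-ym LINE №27 / UV3-NODE §24.5; plan `lit-balaban-r03/G-F3L0-PLAN.md`) of `B8Prop3MultiLevelTorusLap`:
the same declarations, SAME NAMES AND STATEMENTS, for nested families WITH print's region `Λ₀ = T ∖ Ω₁` ADMITTED (structures
`B6MultiLevelBoxOperatorL0.Domains` / `B6MultiLevelTorusOperatorL0.TDomains`: levels `0, …, k`, the level-`0` block a single site, `Q′₀ = id`,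
finite weight `a₀` — print p.225 (2.14) «Σ_{j=0}^k … (Q′₀λ)(x) = λ(x), x ∈ Λ₀», p.229 «taking a sequence (2.1) … smallest possible domains B^j(Λ_j),
and considering the operator Δ_a defined by (2.19), (2.20) for this sequence»).  Every `D`-free object is the lineage's, consumed BY NAME; no existing
module is touched; no fact is minted.  LEVEL-0 JOINT J6 (this file): the three (2.88)-consuming theorems `ineq159_lap_member_pref`,
`prop3_multiLevelTorus_V1_pref_lap`, `prop3_multiLevelTorus_V1_pref_vecLap` take an explicit binder `1 ≤ k →` right after `∀ (k Mh R : ℕ),` (fed to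
`B6Dg288ChartV1L0.hasMajorant_Dg_V1`, whose level sum needs it); everything else verbatim.  Sub-row G-F3′-L0∕B8 («N05 cone», ME #33; `lit-balaban-lead/ROW-G-F3p-L0.md` §7): unit `lit-balaban-r05`
(B8 fold owner, r05 gen 76), port discipline of `lit-balaban-r03` (port.py → reduce.py → by-name imports → dedup); referee ref-4.  THE TWIN'S DOCUMENTATION
FOLLOWS VERBATIM (its «levels 1 … k» / «Ω₁ = X» sentences describe the twin; here `j` runs from `0` and `Ω₁` may be a proper subset).

# `Balaban1983to89.B8Prop3MultiLevelTorusLap` — T. Bałaban, *Spaces of regular gauge field configurations on a lattice and gauge fixing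
# conditions*, Commun. Math. Phys. **99** (1985) 75–102 [Balaban1985RegularSpaces], **(1.59)** p. 86 «Theorem 3.3 of [4] implies the bounds:
# |A|₍₋₁₎, |∇^η_{U₀}A|₍₋₂₎, |D^{η*}_{U₀}D^η_{U₀}A|₍₋₃₎, |Δ^η_{U₀}A|₍₋₃₎ ≦ B₀(|J|₍₋₃₎ + |B₁|)» — **THE FOURTH MEMBER `|Δ^η_{U₀}A|₍₋₃₎` AND
# PROPOSITION 3 (p. 87) AT THE FLAT BACKGROUND U₀ = 1 ON THE `k`-LEVEL V1 TORUS WITH THE (2.136)₄-SHAPE HYPOTHESIS DISCHARGED**: for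
# print's flat vector Laplacian `Δ = ∂*∂ + ∂∂*` ([B5] (1.69), [B6] (2.19)) the solution `A` of (1.55) `∂*∂A = J`, (1.42) `R∂*A = 0` has
# `ΔA = J + ∂P∂*A` EXACTLY (`P = 1 − R`), and `∂P∂*` carries the hypothesis-free [B6] (2.88) majorant on the V1 torus (p22's
# `B6Dg288ChartV1L0.hasMajorant_Dg_V1`); hence `|ΔA|₍₋₃₎ ≦ |J|₍₋₃₎ + K_Δ|A|₍₋₁₎`, and Proposition 3 at U₀ = 1 needs the [B6] Prop. 2.6
# majorants of `G(1)` and `∇G(1)` ONLY ((2.136)₁,₂ — r03's ROUTE V), no longer that of `ΔG(1)`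

statement-level skeleton of published theorems with citation tags; proofs where landed; nothing here is a claim about the Yang–Mills mass gap

PDF held: `paper:balaban1985-cmp99-regular-spaces-gauge-fixing` (journal page = PDF page + 74); pp. 82–87 [PDF 8–13] re-read this generation on
the text layer (`lit read … --pages 2-14`: p0008.txt (1.36)–(1.38), p0009.txt (1.39)–(1.42), p0012.txt (1.55)–(1.60), p0013.txt Prop. 3);
[B6] = T. Bałaban, *Propagators and renormalization transformations for lattice gauge theories. II*, Commun. Math. Phys. **96** (1984) 223–250
[Balaban1984PropagatorsII], pp. 226, 233–235, 247–248 [PDF 4, 11–13, 25–26] re-read this generation (`paper:balaban1984-cmp96-propagators-rt-ii`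
p0011–p0013, p0025–p0026; (2.19) through p21's verbatim quotation in `B6SectAVectorModelV1`); [B5] = T. Bałaban, *Propagators and
renormalization transformations for lattice gauge theories. I*, Commun. Math. Phys. **95** (1984) 17–40 [Balaban1984PropagatorsI], (1.69) p. 29
and (1.21) p. 21 through the verbatim quotations of `B5Eq172HodgePositivity` / `LatticeFieldCalculus` (referee-signed files); [4] = T. Bałaban,
*Propagators for lattice gauge theories in a background field*, Commun. Math. Phys. **99** (1985) 389–434 [Balaban1985BackgroundPropagators]
pp. 392–399 [PDF 4–11] re-read this generation (`paper:balaban1985-cmp99-background-propagators` p0004, p0006–p0007, p0009–p0012).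

CITATION HEADER (lean-in-tree rule).  Cell `lit-balaban` (HOME `run/shared/lean/pub/lit-balaban/`), unit `lit-balaban-r05` gen 63 (B8
reader/typer and fold owner; free target under protocol G.5-34(d), TAKING HOME/STATUS.md 2026-08-23T07:32Z, cc r03 / p22; the successor step of
`B8Prop3MultiLevelTorusEta` p355741 ACCEPTED commit 32b7e8f66f86, HOME/lit-balaban-r05/HANDOFF.md § gen 62).  WHAT IS REPRODUCED = SKELETON rows
**B8.Eq1.59** (the `|Δ^η_{U₀}A|₍₋₃₎` member) and **B8.Prop3** (cells only; heads unchanged) with a courtesy reading of [B6] (2.19)/(2.22) (row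
B6.Eq2.19, r03/p21), as «kernel-checked proofs of a model instance» on p21's `k`-level nested torus family (`TDomains d ℓ M_h k P′ R`,
`Ω₁ = T_η`) carrying r03's V1 global torus calculus (`B6GlobalChartV1`: `PV`, `blkV1`, `domT`; `B6SectAVectorModelV1`: `Δ_a = deltaAE`,
`G(1) = GE = Δ_a⁻¹`).  WHY: the predecessor `B8Prop3MultiLevelTorusEtaL0.prop3_multiLevelTorus_V1_pref` delivers Proposition 3 at U₀ = 1 modulo
THREE (2.136)-shape majorants — of `onFun G(1)` (slot 1, produced by r03's ROUTE V), of `Dop ν ∘ onFun G(1)` (slot 2, the `∇G` legs of ROUTE V)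
and of `Lop ∘ onFun G(1)` for an ARBITRARY second-order `Lop` (slot 3, the (2.136)₄ entry `|(ΔGJ)(x)| ≦ O(1)·1·e^{−δ₃d}|J|`, which NO seat
produces: the B6 side's `k`-level assembly carries `G` and `∇G` legs only).  THIS FILE removes slot 3 for print's own `Δ`.

THE ROUTE, AND WHERE IT DEVIATES FROM PRINT (CONVENTIONS: «deviate only where the tree already provides a step or a genuinely shorter road; say
which»).  PRINT: p. 86 obtains all four members of (1.59) at once from [4] Theorem 3.3 («the operator G(U) (a = 1) satisfies the inequalities
(3.42)–(3.47)»), whose fourth sup entry is the `Δ_U G(U)` kernel bound, proved in [4]/[B6] through the random-walk expansion (2.141) with local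
elliptic estimates ([B6] p. 247 «Reasoning in the same way as in the proof of Proposition 2.2 we obtain Proposition 2.6»).  HERE, at `U₀ = 1`: [B6]
(2.19) p. 226 *"Δ_a = ∂*∂ + ∂R∂* + Q*aQ = Δ − ∂P∂* + Q*aQ"* (so print's `Δ` on vector fields is `∂*∂ + ∂∂*`, as [B5] (1.69) p. 29 spells out:
*"⟨A, Δ_aA⟩ = … = ⟨A, ΔA⟩ − ⟨A, ∂P∂*A⟩ + a⟨A, Q*QA⟩, Δ = ∂*∂ + ∂∂*, R = I − P"*) gives, for the solution `A` of (1.55) `∂*∂A = J` (= «D^{η*}_{U₀}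
D^η_{U₀}A = J» at `U₀ = 1`) under the Landau condition (1.42) `R∂*A = 0`, the EXACT identity `ΔA = ∂*∂A + ∂∂*A = J + ∂(1 − R)∂*A = J + ∂P∂*A`
(§1) — and `∂P∂*` has the [B6] (2.88) kernel bound «|(∂P∂*)(x, x′)| ≦ O(1)(Lʲη)⁻²(L^{j′}η)^{−d}e^{−δ₂d(y,y′)}» (p. 238), IN THE TREE HYPOTHESIS-FREE for
this very operator on this very carrier: p22's `B6Dg288ChartV1L0.hasMajorant_Dg_V1` (from p21's torus (2.88) `B6Ineq288MultiLevelTorus` through the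
V1↔torus dictionary; it is r03's ROUTE V input `hDg`).  Composing a `((Lʲ)η)⁻²`-prefactor majorant with the `|A|₍₋₁₎` member through [4] p. 398's
Lemma-2.1 device («we may replace the factor (Lʲη)^α by (Lʲη)^β(L^{j′}η)^γ») is this lineage's engine, here made prefactor-generic (§2).  So the
fourth member costs NO input beyond slot 1.  (The componentwise spelling `Σ_μ∇_μ*∇_μ` of the flat vector Laplacian — [B5] (1.21) p. 21 «⟨∂A, ∂A⟩ =
Σ_μ⟨A_μ, ΔA_μ⟩ − ⟨∂*A, ∂*A⟩», the B6 side's `Lap` of `B6BlockDecayGLapBridgeV1`/`B6LapCommutesGradV1` — coincides with `∂*∂ + ∂∂*` on the flat torus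
by the lattice Weitzenböck identity; see HONEST SCOPE (ii).)

WHAT IS PRINTED (verbatim).  B8 p. 86 [PDF 12]: *"They imply finally A = G(U₀)J − G(U₀)D^{η*}_{U₀}D_{U₀}H(U₀)B₁ + H(U₀)B₁ = G(U₀)J + G(U₀)Σ_jQ*_jΛ_j
(L^jη)⁻³B₁, (1.58) where the operator G(U₀) was introduced and investigated in [4]. Let us recall only the definition: G(U₀) = (D^{η*}_{U₀}D^η_{U₀} +
D^η_{U₀}R(U₀)D^{η*}_{U₀} + Σ_jQ*_jΛ_j(L^jη)⁻²Q_j)⁻¹.  Theorem 3.3 of [4] implies the bounds: |A|₍₋₁₎, |∇^η_{U₀}A|₍₋₂₎, |D^{η*}_{U₀}D^η_{U₀}A|₍₋₃₎,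
|Δ^η_{U₀}A|₍₋₃₎ ≦ B₀(|J|₍₋₃₎ + |B₁|) ≦ … (1.59)"*; p. 86: *"|A|₍α₎ = sup_j sup_{Ω_j}(L^jη)^{−α}|A|"*; p. 83 [PDF 9]: *"we have the following bounds for
the second order operators acting on A: |D^{η*}_{U₀}D^η_{U₀}A|, |Δ^η_{U₀}A| < B₁(α₀ + α₁)(L^jη)⁻³ on Ω_j, j = 0, 1, …, k. (1.39)"*; Prop. 3 p. 87 [PDF 13]:
*"then U₁ satisfies (1.36)–(1.39) with B₁ = 5dLB₀, B₂(β₀) = 5dLB₀(β₀), where B₀, B₀(β₀) are the corresponding norms of the operators G(U₀), H(U₀),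
and depend on d and L only"*; (1.42) p. 83: *"R(U₀)D^{η*}_{U₀}A = 0, Q_j(U₀, ηA) = B on Λ_j"*.  [B6] (2.19) p. 226, (2.22) «G = Δ_a⁻¹», (2.88) p. 238,
(2.16) p. 225 (the weight band), Prop. 2.6 (2.136) p. 247; [B5] (1.69) p. 29; [4] Theorem 3.3 p. 399, (3.47) p. 398, (3.25) p. 394 «Rf = (I −
G′Q′*(Q′G′²Q′*)⁻¹Q′G′)f» (so `P = 1 − R = G′Q′*(Q′G′²Q′*)⁻¹Q′G′`).

WHAT THIS FILE PROVES (theorems only; 0 `def`, 0 `def … : Prop`, 0 sorry; imports `B8Prop3MultiLevelTorusEta` (own) and `B6Dg288ChartV1` (p22)).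
* §1 ALGEBRA on every nested family `Dm : Domains Pm` of the V1 calculus, every factor `c`, weights `w`: **`deltaAE_eq_hodge_form`** — (2.19)
  second form «Δ_a = Δ − ∂P∂* + Q*aQ» with `Δ := ∂*∂ + ∂∂* = dcsE c ∘ dcE c + dE c ∘ dsE c`, `P = 1 − RE`; **`hodge_comp_GE`** — «ΔG(1) = 1 +
  ∂P∂*G(1) − Q*aQG(1)» ((2.22)); **`hodge_apply_eq_of_solution`** — (1.55) + (1.42) ⟹ `ΔA = J + ∂(1 − R)∂*A`.
* §2 ENGINE **`sup347_pf_eta`** — [4] (3.47) at U = 1 from a (2.136)-shape majorant `C·p(y)·e^{−σd_T}` with an ARBITRARY non-negative level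
  prefactor `p`, `C`-linear, spacing `η` (the prefactor-generic form of `B8Prop3MultiLevelTorusEtaL0.sup347_eta`; `B₀, N₁` functions of `d, ℓ, σ, n`).
* §3 **`ineq159_lap_member_pref`** — (1.59), THE `|Δ^η_{U₀}A|₍₋₃₎` MEMBER AT U₀ = 1 ON THE `k`-LEVEL V1 TORUS FOR THE GENUINE `G(1) = Δ_a⁻¹`, in
  r03's ROUTE V letters (slot 1 = `C·pref c′ y·e^{−σd_T}`, window = `GlobalBand b₀ b₁ c′ w`, `η = |c′|⁻¹`), MODULO (2.136)₁ ONLY: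
  `|((∂*∂ + ∂∂*)A)(b)| ≦ (n_J + K_Δ·B₀C(1 + 2b₁)(n_J + β))·((L^{j(b)})η)⁻³` for `|J(b′)| ≦ n_J((L^{j(b′)})η)⁻³`, `|B| ≦ β((Lʲ)η)⁻¹` — «|ΔA|₍₋₃₎ ≦
  |J|₍₋₃₎ + K_Δ|A|₍₋₁₎», `K_Δ = B_E(d+1)C₂₈₈` a function of `d, ℓ`; thresholds: `M_h ≥ 1`, `R·L·M_h ≥ N₁ + 1`, `R ≥ 2L`, `L·M_h ≥ M₃`, `P′_μ ≥ 4`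
  (the (2.88) thresholds of p21/p22 added to the Eta file's).
* §4 **`prop3_multiLevelTorus_V1_pref_lap`** — PROPOSITION 3 AT U₀ = 1 ON THE `k`-LEVEL V1 TORUS MODULO THE (2.136)₁,₂ MAJORANTS ONLY:
  `B8Prop3MultiLevelTorusEtaL0.prop3_multiLevelTorus_V1_pref` with `Lop` fixed to `∂*∂ + ∂∂*` and its slot-3 hypothesis GONE; conclusions (1.59) ⟹
  (1.60) ⟹ (1.62) exactly as there (four `msup (ℓ+1) k η ·` members + the three pointwise «on Ω_j» forms) with `B₀′ = K_L(B₀C + 1)(1 + 2b₁)`,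
  `K_L = 1 + K_Δ ≥ 1`, `B₀ = B₀(d, ℓ, σ)` — «depend on d and L only», uniform in the spacing.
* §5 (v1.1, r05 gen 64, 2026-08-23; APPEND-ONLY: one `import` of the light module `B8Eq12HodgeLaplacianV1` (p-id in HOME/FILED.md), two `open`
  names, this theorem and these header lines; §1–§4 byte-identical) **`prop3_multiLevelTorus_V1_pref_vecLap`** — the §4 statement VERBATIM with the
  fourth `msup` member and the third pointwise member written for PRINT'S OWN `Δ^η_{U₀}` at `U₀ = 1`, the COMPONENTWISE lattice Laplacian
  `b ↦ (ΔA_{μ(b)})(x(b))` (`LatticeFieldCalculus.laplace c′`; = [4] (3.23) `Σ_ν D^{η*}_{1,ν}D^η_{1,ν}` on the component,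
  `B8Eq12HodgeLaplacianV1.sum_covDAdj_covD_one`), obtained from §4 by the flat lattice Weitzenböck identity `(∂*∂ + ∂∂*)A = (ΔA_μ)_μ` now in the tree
  as an operator identity on `BondSpace` (`B8Eq12HodgeLaplacianV1.hodge_apply` / `ofLp_hodge`) — HONEST SCOPE (ii) below is thereby CLOSED.

HONEST SCOPE / NOT CLAIMED.  (i) SLOTS 1 AND 2 REMAIN ARGUMENTS: the (2.136)₁ majorant of `onFun G(1)` (r03's ROUTE V: `B6CubeWindowV1.
prop26_2136_kLevel_cubes_band` modulo its (2.134) per-cube inputs, in progress r03 g21 / p38 / p22 / p21) and the (2.136)₂ majorants of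
`Dop ν ∘ onFun G(1)` for the abstract first-order `Dop ν`; the hypothesis-free `…P26` twin is their landing's business.  (ii) THE LAPLACIAN IS
PRINT'S `Δ = ∂*∂ + ∂∂*` OF [B5] (1.69) / [B6] (2.19) (`dcsE c ∘ dcE c + dE c ∘ dsE c`, the SAME factor `c` as in `Δ_a`); its identification with the
componentwise `Σ_μ∇_μ*∇_μ` ([B5] (1.21); the B6 side's `Lap`; [B8]'s `Δ^η_{U₀}|_{U₀ = 1}` acting on the components `A_ν`) is the flat lattice
Weitzenböck identity — in the tree at the quadratic-form level on other carriers (`HiggsHodgeIdentity.vecLaplaceForm_eq_curl_add_div`,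
`B5Action121.action_identity_121`), NOT restated here as an operator identity on `BondSpace` (a successor item) — v1.1: DONE in
`B8Eq12HodgeLaplacianV1` (`hodge_apply`, `hodge_eq_sum_DadjD`, `hodge_apply_eq_sum_covDAdj_covD_one`) and consumed by §5.  (iii) Conditional, like the Eta
file, on (1.55)/(1.42)/(1.56) as hypotheses on the given `A` (print derives them on pp. 84–86 from (1.40)–(1.42); the (1.43)–(1.55) algebra is
𝔸-valued and lives in `B8Ineq145*`/`B8Eq146AExpansion`, not on V1) and on the size lines (1.55)/(1.56)/(1.61) as hypotheses on numbers; real scalar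
fibre; lattice units of the V1 torus with the spacing read as `η = |c′|⁻¹`; levels `1 … k`, `Ω₁ = T_η`; constants existential, thresholds explicit.
(iv) Rows B8.Eq1.59 / B8.Prop3 heads do NOT move (general background `U₀ ∈ 𝔄_k` = [4] Thm 3.3, r06's block; owner's standing word).  NOT summit
progress, NOT continuum, NOT Clay.

RELATED IN THE TREE, NOT DUPLICATED (stem check 2026-08-23T07:30Z: `ls Balaban1983to89 | grep -i 'lap\|hodge'` — B5/B6/B9 Laplacian files of
other lineages (`B6Prop22Lap*`, `B6BlockDecayLap*V1`, `B6LapCommutesGradV1`, `B6Ineq2133GDivLapTwoScaleV1` = the two-scale member `ΔG_□` legs of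
p22, `HiggsHodgeIdentity`, `B5Laplace*`), none on the B8 (1.59)/Prop. 3 package; `grep -l hasMajorant_Dg_V1` = `B6Dg288ChartV1`,
`B6MemberTorusTDomainsV1`, `B6Prop26KLevelSkeletonV1` (B6 side only)): `B8Prop3MultiLevelTorusEta.*`, `B8Prop3MultiLevelTorus.*`,
`B8Ineq159MultiLevelTorus.*` (predecessors, USED BY NAME, not modified), `B6Dg288ChartV1L0.hasMajorant_Dg_V1`, `B6SectAVectorModelV1.deltaAE_def/
deltaAE_comp_GE`, `B6RandomWalk.hasMajorant_zero/mono` (USED BY NAME).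
-/

namespace Literature.MathematicalPhysics.QuantumFieldTheory.Balaban1983to89.B8Prop3MultiLevelTorusLapL0

open Finset
open B4Reflection242 (boxDom)
open B6MultiLevelBoxOperator hiding Domains mlOp_apply
open B6MultiLevelBoxOperatorL0
open B6MultiLevelTorusOperator hiding TDomains mlOpT_apply mlOpT_eq_reindex_chart mlOpT_mul_reindex mlOpT_tshift
open B6MultiLevelTorusOperatorL0
open B6Geom246MultiLevelBox hiding Touch blkOf blkOf_corner blkOf_eq_iff_blk blkOf_eq_of_blk_i_eq blkOf_val bond bond_adj bset cen connected coord_bounds corner corner_mem csys dist_blkOf_le_box dist_blkOf_le_coord dist_blkOf_le_line dist_cen_le_of_adj dist_cen_le_of_touch dist_le_one_of_near dist_toR_cen_le exists_blkOf_eq geom lemma21_box lev_corner lev_eq_of_blkOf_eq levelGap pack reachable_blkOf reachable_of_near realizes scale_bounds touch_symm triangle_refl_nonneg walk_disp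
open B6Geom246MultiLevelBoxL0
open B6Geom246MultiLevelTorus hiding TouchT blkHom blkMap blkMap_blkOf blkMap_injective blkMap_surjective blkOf_tshift_eq bondT bondT_adj bond_le_bondT connectedT csysT distT_le_dist_box distT_le_dist_chart dist_posT_le_of_adj dist_posT_le_of_touchT dist_site_posT_le geomT label_bounds lemma21_torus levelGapT packT posT realizesT touchT_symm triangle_refl_nonneg_T walk_dispT
open B6Geom246MultiLevelTorusL0
open B6RandomWalk (HasMajorant BlockSupp hasMajorant_mono hasMajorant_zero)
open B6Ineq261LevelGap (K261 K261_nonneg)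
open B8Ineq192MultiLevelTorusL0
open B8Ineq198MultiLevelTorusL0 (rowSum_and_thresholdT)
open B8Ineq159MultiLevelTorus (eq158_line2_V1)
open B8Ineq159MultiLevelTorusL0 (apply_le_of_invPow_blk len_blkV1)
open B6GlobalChartV1 (PV toBox)
open B6GlobalChartV1L0 (blkV1 domT)
open B6SectAOperatorsV1 (dE dsE dcE dcsE QE QsE aE RE BondIdx BondIdxSpace ScalarSpace)
open B6SectAVectorModelV1 (deltaAE GE deltaAE_def deltaAE_comp_GE GE_deltaAE)
open BalabanImbrieJaffe1984to88.BIJ85AxialPropagator411 (BondSpace)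
open B6Ineq2133TwoScaleV1 (onFun onFun_apply)
open B6CubeWindowV1 (GlobalBand)
open B6Prop26KLevelSkeletonV1L0 (pref)
open B8ScaledSupNorm (msup msup_nonneg)
open B8Prop3MultiLevelTorusEtaL0 (prop3_multiLevelTorus_V1_pref ineq159_A_member_pref pref_eq window_of_globalBand msup_le_of_pointwise_blk_eta pointwise_of_msup_le_blk_eta)
open B6Dg288ChartV1L0 (hasMajorant_Dg_V1)
open LatticeFieldCalculus (laplace)
open B8Eq12HodgeLaplacianV1 (hodge_apply ofLp_hodge)
open Literature.MathematicalPhysics.QuantumFieldTheory.Balaban1983to89.B8Prop3MultiLevelTorusLap (deltaAE_eq_hodge_form hodge_comp_GE hodge_apply_eq_of_solution)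

noncomputable section

variable {d : ℕ}

/-- the cast of the block side `L = ℓ + 1`. [folklore] -/
private theorem castL (ℓ : ℕ) : (((ℓ + 1 : ℕ) : ℝ)) = (ℓ : ℝ) + 1 := by push_cast; ring

/-! ## §1  The algebra of [B6] (2.19) / [B5] (1.69): `Δ_a = Δ − ∂P∂* + Q*aQ` with `Δ = ∂*∂ + ∂∂*`, and `ΔA = J + ∂P∂*A` for the solution -/

section Algebra

variable {Pm : Params} (Dm : B6SectADomainsV1.Domains Pm)

end Algebra

/-! ## §2  The [4] (3.47) / Lemma-2.1 engine with an ARBITRARY non-negative level prefactor, `C`-linear, with the spacing `η` -/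

section Engine

/-- **[4] (3.47) AT U = 1 ⇐ A (2.136)-SHAPE MAJORANT WITH AN ARBITRARY NON-NEGATIVE PREFACTOR `p(y)`, `C`-LINEAR, SPACING `η`** ([4] p. 398
«Using Lemma 2.1 … we may replace the factor (Lʲη)^α by (Lʲη)^β(L^{j′}η)^γ with β + γ = α»): for every decay rate `σ > 0` and input weight exponent
`n` there are `B₀ ≥ 1`, `N₁ ≥ 1`, FUNCTIONS OF `d, ℓ, σ, n` ONLY, such that for every `k`, `M_h ≥ 1`, `R·L·M_h ≥ N₁ + 1`, torus size `P`, nested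
torus family `D`, spacing `η > 0`, prefactor `p ≥ 0` on `𝔅`, carrier `X` with block map `blk`, operator `T` and constant `C ≥ 0` with
«|(Tμ)(x)| ≦ C·p(y)·e^{−σd(y,y′)}|μ|, x ∈ Δ(y), supp μ ⊂ Δ(y′)», and every `u` with `|u(z)| ≦ S((L^{j(z)})η)⁻ⁿ`:
`|(Tu)(x)| ≦ B₀·C·p(y(x))·((L^{j(x)})η)⁻ⁿ·S` (the prefactor-generic form of `B8Prop3MultiLevelTorusEtaL0.sup347_eta`; here used with `p(y) = ((Lʲ)η)⁻²`,
the (2.88) prefactor of `∂P∂*`).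
[cite: Balaban1985BackgroundPropagators, (3.47) p.398, (3.41) p.397; Balaban1984PropagatorsII, Lemma 2.1 (2.60)–(2.61) p.234, (2.52)–(2.55) p.232, (2.88) p.238; Balaban1985RegularSpaces, (1.59) p.86, p.86 (definition after (1.55))] -/
theorem sup347_pf_eta (d ℓ : ℕ) {σ : ℝ} (hσ : 0 < σ) (n : ℕ) :
    ∃ B₀ : ℝ, ∃ N₁ : ℕ, 1 ≤ B₀ ∧ 0 < N₁ ∧
      ∀ (k Mh R : ℕ), 1 ≤ Mh → N₁ + 1 ≤ R * ((ℓ + 1) * Mh) →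
      ∀ (P : Fin (d + 1) → ℕ) (_hP : ∀ μ, 1 ≤ P μ) (D : B6MultiLevelTorusOperatorL0.TDomains d ℓ Mh k P R) (η : ℝ), 0 < η →
        ∀ (pf : ↥(bset D.toDomains) → ℝ), (∀ y, 0 ≤ pf y) →
        ∀ (X : Type) (blk : X → ↥(bset D.toDomains)) (T : Module.End ℝ (X → ℝ)) (C : ℝ), 0 ≤ C →
        HasMajorant (g := geomT D) blk T
          (fun y y' => C * pf y * Real.exp (-(σ * (geomT D).dist y y'))) →
        ∀ (u : X → ℝ) (S : ℝ), 0 ≤ S → (∀ z, |u z| ≤ S * (((geomT D).len (blk z) * η) ^ n)⁻¹) →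
          ∀ x : X, |T u x| ≤ B₀ * C * pf (blk x) * (((geomT D).len (blk x) * η) ^ n)⁻¹ * S := by
  have hL0 : (0 : ℝ) < (ℓ : ℝ) + 1 := by positivity
  -- Lemma 2.1 / absorption at the rate `σ/2` (majorant rate `σ = σ/2 + σ/2`)
  obtain ⟨τ, hτ⟩ : ∃ τ : ℝ, τ = σ / 2 := ⟨_, rfl⟩
  have hτ0 : 0 < τ := by rw [hτ]; positivity
  obtain ⟨N₁, hN₁⟩ : ∃ N₁ : ℕ, N₁ = ⌈(2 * ((d : ℝ) + 1) + n + 1) * ((ℓ : ℝ) + 1) / τ⌉₊ + 1 := ⟨_, rfl⟩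
  have hN₁pos : 0 < N₁ := by rw [hN₁]; omega
  obtain ⟨cK, hcK⟩ : ∃ cK : ℝ, cK = K261 N₁ (d + 1) ((ℓ : ℝ) + 1) 1 (1 * τ) := ⟨_, rfl⟩
  have hcK0 : 0 ≤ cK := by rw [hcK]; exact K261_nonneg hL0.le zero_le_one
  have hB0 : 0 ≤ ((ℓ : ℝ) + 1) ^ n * cK := mul_nonneg (pow_nonneg hL0.le n) hcK0
  refine ⟨((ℓ : ℝ) + 1) ^ n * cK + 1, N₁, by linarith, hN₁pos, ?_⟩
  intro k Mh R hMh1 hRM1 P hP D η hη pf hpf X blk T C hC hT u S hS hu x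
  have hRMone : 1 ≤ R * ((ℓ + 1) * Mh) := le_trans (by omega) hRM1
  obtain ⟨hrow, hthr⟩ := rowSum_and_thresholdT (D := D) hMh1 hP hτ0 n hN₁ hRM1
  rw [← hcK] at hrow
  have hlen0 : ∀ y : ↥(bset D.toDomains), 0 ≤ (geomT D).len y := fun y => (lenT_pos D y).le
  have hrate : τ + τ ≤ σ := by rw [hτ]; linarith
  have hηn : 0 < η ^ n := pow_pos hη n
  -- the input with the constant `S(ηⁿ)⁻¹` in lattice units
  have hu' : ∀ z, |u z| ≤ S * (η ^ n)⁻¹ * ((geomT D).len (blk z) ^ n)⁻¹ := fun z => by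
    refine (hu z).trans (le_of_eq ?_)
    rw [mul_pow, mul_inv]
    ring
  have hA : 0 ≤ S * (η ^ n)⁻¹ := mul_nonneg hS (inv_nonneg.2 hηn.le)
  have h := apply_le_of_invPow_blk (D := D) hMh1 hP hRMone blk (σ := σ) (β := τ) (τ := τ) (c := cK) hC hτ0.le
    hrate (pf := pf) hpf hT (hrow τ le_rfl) n hthr hA hu' x
  refine h.trans ?_
  show S * (η ^ n)⁻¹ * C * pf (blk x) * (((ℓ : ℝ) + 1) ^ n * cK) * ((geomT D).len (blk x) ^ n)⁻¹ ≤ _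
  have hq : 0 ≤ C * (pf (blk x) * ((((geomT D).len (blk x) * η) ^ n)⁻¹ * S)) :=
    mul_nonneg hC (mul_nonneg (hpf _) (mul_nonneg (inv_nonneg.2 (pow_nonneg (mul_nonneg (hlen0 _) hη.le) n)) hS))
  have heq : S * (η ^ n)⁻¹ * C * pf (blk x) * (((ℓ : ℝ) + 1) ^ n * cK) * ((geomT D).len (blk x) ^ n)⁻¹ =
      (((ℓ : ℝ) + 1) ^ n * cK) * (C * (pf (blk x) * ((((geomT D).len (blk x) * η) ^ n)⁻¹ * S))) := by
    rw [mul_pow, mul_inv]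
    ring
  rw [heq]
  calc (((ℓ : ℝ) + 1) ^ n * cK) * (C * (pf (blk x) * ((((geomT D).len (blk x) * η) ^ n)⁻¹ * S)))
      ≤ (((ℓ : ℝ) + 1) ^ n * cK + 1) * (C * (pf (blk x) * ((((geomT D).len (blk x) * η) ^ n)⁻¹ * S))) :=
        mul_le_mul_of_nonneg_right (by linarith) hq
    _ = (((ℓ : ℝ) + 1) ^ n * cK + 1) * C * pf (blk x) * (((geomT D).len (blk x) * η) ^ n)⁻¹ * S := by ring

end Engine

/-! ## §3  (1.59), THE FOURTH MEMBER «|Δ^η_{U₀}A|₍₋₃₎» AT U₀ = 1 ON THE `k`-LEVEL V1 TORUS WITH SLOT 3 DISCHARGED: from the `|A|₍₋₁₎` member and [B6] (2.88) -/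

section LapMember

/-- **(1.59), THE `|Δ^η_{U₀}A|₍₋₃₎` MEMBER AT U₀ = 1 ON THE `k`-LEVEL V1 TORUS FOR THE GENUINE `G(1) = Δ_a⁻¹`, IN r03's ROUTE V LETTERS, MODULO
THE (2.136)₁ MAJORANT ONLY** («Theorem 3.3 of [4] implies the bounds: |A|₍₋₁₎, …, |Δ^η_{U₀}A|₍₋₃₎ ≦ B₀(|J|₍₋₃₎ + |B₁|)»; print's flat vector
Laplacian `Δ = ∂*∂ + ∂∂*` of [B5] (1.69) / [B6] (2.19)): there are `B₀ ≥ 1`, `K_Δ ≥ 0`, `M₃ > 0`, `N₁ ≥ 1` — functions of `d, ℓ, σ` only («depend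
on d and L only») — such that on every admissible torus datum (`M_h ≥ 1`, `R·L·M_h ≥ N₁ + 1`, `R ≥ 2L`, `L·M_h ≥ M₃`, periods `P′_μ ≥ 4`, `D`, V1
volume with `hN`, `hk`), for every factor `c′ ≠ 0` (spacing `η = |c′|⁻¹`), weights `w > 0` in print's (2.16) band `GlobalBand b₀ b₁ c′ w` (`0 ≤ b₀,
b₁`) and EVERY `C ≥ 0`: IF `onFun (GE (domT hN D hk) hc′ hw)` has the (2.136)₁ majorant `C·pref c′ y·e^{−σd_T}` on `blkV1 hN D` (r03's conclusion
shape), THEN every vector field `A` with (1.55) `∂*∂A = J`, (1.42) `R∂*A = 0`, (1.56) `QA = B`, `|J(b)| ≦ n_J((L^{j(b)})η)⁻³`, `|B_{(j,c)}| ≦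
β((Lʲ)η)⁻¹` obeys, at every fine bond `b` of level `j`,
`|((∂*∂ + ∂∂*)A)(b)| ≦ (n_J + K_Δ·B₀C(1 + 2b₁)(n_J + β))·((Lʲ)η)⁻³` — i.e. «|ΔA|₍₋₃₎ ≦ |J|₍₋₃₎ + K_Δ|A|₍₋₁₎ ≦ B₀″(|J|₍₋₃₎ + |B₁|)».
ROUTE (ours, at U₀ = 1; print's is [4] (3.47)₄ via Theorem 3.3): `ΔA = J + ∂(1 − R)∂*A` (§1) and the HYPOTHESIS-FREE [B6] (2.88) majorant of
`∂(1 − R)∂*` on the V1 torus (p22's `B6Dg288ChartV1L0.hasMajorant_Dg_V1`, prefactor `((Lʲ)η)⁻²`, from p21's torus (2.88)) applied to the `|A|₍₋₁₎`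
member (`B8Prop3MultiLevelTorusEtaL0.ineq159_A_member_pref`) through the Lemma-2.1 engine `sup347_pf_eta` (`K_Δ = B_E·(d+1)·C₂₈₈`).
[cite: Balaban1985RegularSpaces, (1.59) p.86, (1.55)–(1.58) p.86, (1.42) p.84, Prop. 3 p.87; Balaban1984PropagatorsII, (2.19) p.226, (2.88) p.238, (2.16) p.225, Prop. 2.6 (2.136) p.247, Lemma 2.1 (2.60)–(2.61) p.234; Balaban1984PropagatorsI, (1.69) p.29; Balaban1985BackgroundPropagators, Theorem 3.3 p.399, (3.47) p.398] -/
theorem ineq159_lap_member_pref (d ℓ : ℕ) (hd : 1 ≤ d + 1) (hL : Odd (ℓ + 1) ∧ 1 < ℓ + 1) {σ : ℝ} (hσ : 0 < σ) :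
    ∃ B₀ KΔ M₃ : ℝ, ∃ N₁ : ℕ, 1 ≤ B₀ ∧ 0 ≤ KΔ ∧ 0 < M₃ ∧ 0 < N₁ ∧
      ∀ (k Mh R : ℕ), 1 ≤ k → 1 ≤ Mh → N₁ + 1 ≤ R * ((ℓ + 1) * Mh) → 2 * (ℓ + 1) ≤ R → M₃ ≤ ((ℓ : ℝ) + 1) * Mh →
      ∀ (P' : Fin (d + 1) → ℕ) (_hP : ∀ μ, 4 ≤ P' μ) (D : B6MultiLevelTorusOperatorL0.TDomains d ℓ Mh k P' R)
        (m K : ℕ) (hN : ∀ μ, N0 ℓ Mh k P' μ = (PV d ℓ m K hd hL).sitesPerDir 0) (hk : k ≤ m + K)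
        (cf : ℝ) (hcf : cf ≠ 0) (w : BondIdx (domT hN D hk) → ℝ) (hw : ∀ i, 0 < w i)
        (b₀ b₁ : ℝ), 0 ≤ b₀ → 0 ≤ b₁ → GlobalBand b₀ b₁ cf w →
        ∀ (C : ℝ), 0 ≤ C →
        HasMajorant (g := geomT D) (blkV1 hN D) (onFun (GE (domT hN D hk) hcf hw))
          (fun y y' => C * pref cf y * Real.exp (-(σ * (geomT D).dist y y'))) →
        ∀ (A J : BondSpace (PV d ℓ m K hd hL)) (B : BondIdxSpace (domT hN D hk)),
          dcsE cf (dcE cf A) = J → RE (domT hN D hk) cf (dsE cf A) = 0 → QE (domT hN D hk) A = B →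
          ∀ (nJ β : ℝ), 0 ≤ nJ → 0 ≤ β →
            (∀ b, |J b| ≤ nJ * (((geomT D).len (blkV1 hN D b) * |cf|⁻¹) ^ 3)⁻¹) →
            (∀ i, |B i| ≤ β * (((ℓ : ℝ) + 1) ^ (i.1.1 : ℕ) * |cf|⁻¹)⁻¹) →
            ∀ b : PBond (PV d ℓ m K hd hL) 0,
              |(dcsE cf (dcE cf A) + dE cf (dsE cf A)) b| ≤
                (nJ + KΔ * (B₀ * C * (1 + 2 * b₁) * (nJ + β))) * (((geomT D).len (blkV1 hN D b) * |cf|⁻¹) ^ 3)⁻¹ := by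
  -- the (2.88) constants of `∂P∂*` on the V1 torus (p22/p21), functions of `d, ℓ`
  obtain ⟨M₃, δ₂, CDg, hM₃, hδ₂, hCDg, hDg⟩ := hasMajorant_Dg_V1 d ℓ hd hL
  -- the Lemma-2.1 engine at the rate `δ₂`, input exponent `1` (the `|A|₍₋₁₎` member is the input of `∂P∂*`)
  obtain ⟨BE, NE, hBE, hNE, hE⟩ := sup347_pf_eta d ℓ hδ₂ 1
  -- the `|A|₍₋₁₎` member (slot 1)
  obtain ⟨B₀, N₁, hB₀, hN₁, hAm⟩ := ineq159_A_member_pref d ℓ hσ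
  have hKΔ : 0 ≤ BE * (((d : ℝ) + 1) * CDg) := by
    have : 0 ≤ BE := by linarith
    positivity
  refine ⟨B₀, BE * (((d : ℝ) + 1) * CDg), M₃, N₁ + NE, hB₀, hKΔ, hM₃, by omega, ?_⟩
  intro k Mh R hk1 hMh1 hRM1 hR2 hM3 P' hP4 D m K hN hk cf hcf w hw b₀ b₁ hb₀ hb₁ hwb C hC hG A J B h55 h42 h56 nJ β hnJ hβ hJ hB b
  have hP1 : ∀ μ, 1 ≤ P' μ := fun μ => le_trans (by norm_num) (hP4 μ)
  have hRM1' : N₁ + 1 ≤ R * ((ℓ + 1) * Mh) := le_trans (by omega) hRM1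
  have hRME : NE + 1 ≤ R * ((ℓ + 1) * Mh) := le_trans (by omega) hRM1
  have hη : 0 < |cf|⁻¹ := inv_pos.2 (abs_pos.2 hcf)
  have hB0' : 0 ≤ B₀ := by linarith
  -- slot 1 ⟹ `|A(b′)| ≦ S_A((L^{j(b′)})η)⁻¹`
  have hA : ∀ b', |A b'| ≤ B₀ * C * (1 + 2 * b₁) * (nJ + β) * ((geomT D).len (blkV1 hN D b') * |cf|⁻¹)⁻¹ :=
    hAm k Mh R hMh1 hRM1' P' hP1 D m K hd hL hN hk cf hcf w hw b₀ b₁ hb₀ hb₁ hwb C hC hG A J B h55 h42 h56 nJ β hnJ hβ hJ hB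
  have hSA : 0 ≤ B₀ * C * (1 + 2 * b₁) * (nJ + β) := by positivity
  -- `∂(1 − R)∂*` with its (2.88) majorant, read with the prefactor `((Lʲ)η)⁻²` and the constant `(d+1)·C₂₈₈`
  have hT := hDg m K hN D hk hk1 hMh1 hP4 hR2 hM3 hcf
  have hT' : HasMajorant (g := geomT D) (blkV1 hN D) (onFun (dE cf ∘ₗ (LinearMap.id - RE (domT hN D hk) cf) ∘ₗ dsE cf))
      (fun y y' => (((d : ℝ) + 1) * CDg) * (((geomT D).len y * |cf|⁻¹) ^ 2)⁻¹ * Real.exp (-(δ₂ * (geomT D).dist y y'))) := by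
    refine hasMajorant_mono (g := geomT D) (blkV1 hN D) hT fun y y' => le_of_eq ?_
    have hl : (geomT D).len y ≠ 0 := (lenT_pos D y).ne'
    have hsq : ((geomT D).len y * |cf|⁻¹) ^ 2 = (geomT D).len y ^ 2 / cf ^ 2 := by
      rw [mul_pow, inv_pow, sq_abs, div_eq_mul_inv]
    rw [hsq, inv_div]
    field_simp
  have hpf : ∀ y : ↥(bset D.toDomains), 0 ≤ (((geomT D).len y * |cf|⁻¹) ^ 2)⁻¹ := fun y =>
    inv_nonneg.2 (pow_nonneg (mul_nonneg (lenT_pos D y).le hη.le) 2)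
  have hA1 : ∀ b', |(WithLp.ofLp A) b'| ≤
      B₀ * C * (1 + 2 * b₁) * (nJ + β) * (((geomT D).len (blkV1 hN D b') * |cf|⁻¹) ^ 1)⁻¹ :=
    fun b' => by rw [pow_one]; exact hA b'
  have hPd := hE k Mh R hMh1 hRME P' hP1 D |cf|⁻¹ hη (fun y => (((geomT D).len y * |cf|⁻¹) ^ 2)⁻¹) hpf _ (blkV1 hN D)
    (onFun (dE cf ∘ₗ (LinearMap.id - RE (domT hN D hk) cf) ∘ₗ dsE cf)) (((d : ℝ) + 1) * CDg) (by positivity) hT'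
    (WithLp.ofLp A) _ hSA hA1 b
  rw [onFun_apply, WithLp.toLp_ofLp] at hPd
  -- `ΔA = J + ∂(1 − R)∂*A` (§1)
  have hΔ := hodge_apply_eq_of_solution (domT hN D hk) cf A J h55 h42
  have hΔb : (dcsE cf (dcE cf A) + dE cf (dsE cf A)) b =
      J b + ((dE cf ∘ₗ (LinearMap.id - RE (domT hN D hk) cf) ∘ₗ dsE cf) A) b := by
    rw [hΔ]; rfl
  rw [hΔb]
  refine (abs_add_le _ _).trans ?_
  have h3 : (((geomT D).len (blkV1 hN D b) * |cf|⁻¹) ^ 2)⁻¹ * (((geomT D).len (blkV1 hN D b) * |cf|⁻¹) ^ 1)⁻¹ =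
      (((geomT D).len (blkV1 hN D b) * |cf|⁻¹) ^ 3)⁻¹ := by
    rw [← mul_inv, ← pow_add]
  have hPd' : |((dE cf ∘ₗ (LinearMap.id - RE (domT hN D hk) cf) ∘ₗ dsE cf) A) b| ≤
      BE * (((d : ℝ) + 1) * CDg) * (B₀ * C * (1 + 2 * b₁) * (nJ + β)) * (((geomT D).len (blkV1 hN D b) * |cf|⁻¹) ^ 3)⁻¹ := by
    refine hPd.trans (le_of_eq ?_)
    rw [← h3]; ring
  rw [add_mul]
  exact add_le_add (hJ b) hPd'

end LapMember

/-! ## §4  PROPOSITION 3 AT U₀ = 1 ON THE `k`-LEVEL V1 TORUS, VECTOR SIDE, MODULO THE (2.136)₁,₂ MAJORANTS ONLY — slot 3 discharged -/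

section Prop3

/-- **PROPOSITION 3 (p. 87) AT U₀ = 1 ON THE `k`-LEVEL V1 TORUS FOR THE GENUINE `G(1) = Δ_a⁻¹`, IN r03's ROUTE V LETTERS, MODULO THE
(2.136)₁,₂-SHAPE MAJORANTS OF `G(1)`, `∇G(1)` ONLY — THE `Δ`-MEMBER UNCONDITIONAL IN `ΔG(1)`** (`B8Prop3MultiLevelTorusEtaL0.prop3_multiLevelTorus_V1_pref`
with its slot 3 — the (2.136)₄-shape majorant of `Lop ∘ onFun G(1)` — DISCHARGED for print's flat vector Laplacian `Δ = ∂*∂ + ∂∂*` of [B5] (1.69) /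
[B6] (2.19) by §3): there are `B₀ ≥ 1`, `K_L ≥ 1`, `M₃ > 0`, `N₁ ≥ 1` (functions of `d, ℓ, σ` — «depend on d and L only») such that on every
admissible torus datum (`M_h ≥ 1`, `R·L·M_h ≥ N₁ + 1`, `R ≥ 2L`, `L·M_h ≥ M₃`, `P′_μ ≥ 4`, `D`, V1 volume with `hN`, `hk`), for every factor
`c′ ≠ 0` (`η = |c′|⁻¹`), weights `w > 0` with `GlobalBand b₀ b₁ c′ w` (`0 ≤ b₀, b₁`), EVERY `C ≥ 0` and linear maps `Dop ν` (for `∇^η_{U₀}|_{U₀=1}`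
componentwise): IF `onFun G(1)` and `Dop ν ∘ onFun G(1)` have the majorants `C·pref c′ y·e^{−σd_T}`, `C(Lʲ)|c′|⁻¹e^{−σd_T}` on `blkV1 hN D`, THEN
for every `A` with (1.55) `∂*∂A = J`, (1.42) `R∂*A = 0`, (1.56) `QA = B`, numbers `n_J, n_B ≥ 0` with `|J(b)| ≦ n_J((L^{j(b)})η)⁻³`,
`|B_{(j,c)}| ≦ n_B((Lʲ)η)⁻¹`, and reals `d_P ≥ 0`, `L_P` (`d_PL_P ≥ 1`), `α₀, α₁, α₂ ≥ 0`, `C₂` subject to (1.55) «|J|₍₋₃₎ ≦ 2α₀ + 36dα₂|∇A|₍₋₂₎ +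
50dα₂³ + 10dα₀α₂», (1.56) «|B₁| < 2dLα₁ + C₂α₂²», p. 86 «B₀′36dα₂ ≦ ½» (+ `50dα₂ ≤ 1`) and (1.61), with **`B₀′ := K_L(B₀C + 1)(1 + 2b₁)`**:
**`|A|₍₋₁₎, |∇A|₍₋₂₎, |J|₍₋₃₎ (= |D*DA|₍₋₃₎), |(∂*∂ + ∂∂*)A|₍₋₃₎ ≦ 5d_PL_PB₀′(α₀ + α₁)`** in `msup (ℓ+1) k η ·`, and, «on Ω_j», the pointwise forms
`|A(b)| ≦ …((L^{j(b)})η)⁻¹`, `|(Dop ν A)(b)| ≦ …((L^{j(b)})η)⁻²`, `|((∂*∂ + ∂∂*)A)(b)| ≦ …((L^{j(b)})η)⁻³` at every fine bond.  Proof: the Eta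
file's theorem run with `Lop := 0` for the three other members and the (1.60)/(1.62) algebra (`B8.apriori_160/162` inside it), plus §3's route for
the `Δ`-member (`K_L = 1 + B_E·(d+1)·C₂₈₈`).
[cite: Balaban1985RegularSpaces, Prop. 3 p.87, (1.59)–(1.62) pp.86–87, (1.55)–(1.58) p.86, (1.42) p.84; Balaban1984PropagatorsII, Prop. 2.6 (2.136) p.247, (2.16) p.225, (2.19) p.226, (2.88) p.238; Balaban1984PropagatorsI, (1.69) p.29; Balaban1985BackgroundPropagators, Theorem 3.3 p.399, (3.47) p.398] -/
theorem prop3_multiLevelTorus_V1_pref_lap (d ℓ : ℕ) (hd : 1 ≤ d + 1) (hL : Odd (ℓ + 1) ∧ 1 < ℓ + 1) {σ : ℝ} (hσ : 0 < σ) :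
    ∃ B₀ KL M₃ : ℝ, ∃ N₁ : ℕ, 1 ≤ B₀ ∧ 1 ≤ KL ∧ 0 < M₃ ∧ 0 < N₁ ∧
      ∀ (k Mh R : ℕ), 1 ≤ k → 1 ≤ Mh → N₁ + 1 ≤ R * ((ℓ + 1) * Mh) → 2 * (ℓ + 1) ≤ R → M₃ ≤ ((ℓ : ℝ) + 1) * Mh →
      ∀ (P' : Fin (d + 1) → ℕ) (_hP : ∀ μ, 4 ≤ P' μ) (D : B6MultiLevelTorusOperatorL0.TDomains d ℓ Mh k P' R)
        (m K : ℕ) (hN : ∀ μ, N0 ℓ Mh k P' μ = (PV d ℓ m K hd hL).sitesPerDir 0) (hk : k ≤ m + K)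
        (cf : ℝ) (hcf : cf ≠ 0) (w : BondIdx (domT hN D hk) → ℝ) (hw : ∀ i, 0 < w i)
        (b₀ b₁ : ℝ) (_hb₀ : 0 ≤ b₀) (_hb₁ : 0 ≤ b₁) (_hwb : GlobalBand b₀ b₁ cf w) (C : ℝ) (_hC : 0 ≤ C)
        (Dop : Fin (d + 1) → Module.End ℝ (PBond (PV d ℓ m K hd hL) 0 → ℝ)),
        HasMajorant (g := geomT D) (blkV1 hN D) (onFun (GE (domT hN D hk) hcf hw))
          (fun y y' => C * pref cf y * Real.exp (-(σ * (geomT D).dist y y'))) →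
        (∀ ν, HasMajorant (g := geomT D) (blkV1 hN D) (Dop ν ∘ₗ onFun (GE (domT hN D hk) hcf hw))
          (fun y y' => C * ((geomT D).len y * |cf|⁻¹) * Real.exp (-(σ * (geomT D).dist y y')))) →
        ∀ (A J : BondSpace (PV d ℓ m K hd hL)) (B : BondIdxSpace (domT hN D hk)),
          dcsE cf (dcE cf A) = J → RE (domT hN D hk) cf (dsE cf A) = 0 → QE (domT hN D hk) A = B →
          ∀ (nJ nB : ℝ), 0 ≤ nJ → 0 ≤ nB →
            (∀ b, |J b| ≤ nJ * (((geomT D).len (blkV1 hN D b) * |cf|⁻¹) ^ 3)⁻¹) →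
            (∀ i, |B i| ≤ nB * (((ℓ : ℝ) + 1) ^ (i.1.1 : ℕ) * |cf|⁻¹)⁻¹) →
          ∀ (dP LP C₂ α₀ α₁ α₂ : ℝ), 0 ≤ dP → 1 ≤ dP * LP → 0 ≤ α₀ → 0 ≤ α₁ → 0 ≤ α₂ →
            nJ ≤ 2 * α₀ + 36 * dP * α₂ *
                msup (ℓ + 1) k |cf|⁻¹ (-2) (fun j (p : Fin (d + 1) × PBond (PV d ℓ m K hd hL) 0) => j ≤ (blkV1 hN D p.2).1.1)
                  (fun p : Fin (d + 1) × PBond (PV d ℓ m K hd hL) 0 => Dop p.1 (WithLp.ofLp A) p.2) +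
              50 * dP * α₂ ^ 3 + 10 * dP * α₀ * α₂ →
            nB ≤ 2 * dP * LP * α₁ + C₂ * α₂ ^ 2 →
            36 * dP * (KL * ((B₀ * C + 1) * (1 + 2 * b₁))) * α₂ ≤ 1 / 2 → 50 * dP * α₂ ≤ 1 →
            2 * α₂ ^ 2 + 20 * dP * α₀ * α₂ + 2 * C₂ * α₂ ^ 2 ≤ α₀ + α₁ →
            msup (ℓ + 1) k |cf|⁻¹ (-1) (fun j (b : PBond (PV d ℓ m K hd hL) 0) => j ≤ (blkV1 hN D b).1.1) (WithLp.ofLp A) ≤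
                5 * dP * LP * (KL * ((B₀ * C + 1) * (1 + 2 * b₁))) * (α₀ + α₁) ∧
              msup (ℓ + 1) k |cf|⁻¹ (-2) (fun j (p : Fin (d + 1) × PBond (PV d ℓ m K hd hL) 0) => j ≤ (blkV1 hN D p.2).1.1)
                  (fun p : Fin (d + 1) × PBond (PV d ℓ m K hd hL) 0 => Dop p.1 (WithLp.ofLp A) p.2) ≤
                5 * dP * LP * (KL * ((B₀ * C + 1) * (1 + 2 * b₁))) * (α₀ + α₁) ∧
              nJ ≤ 5 * dP * LP * (KL * ((B₀ * C + 1) * (1 + 2 * b₁))) * (α₀ + α₁) ∧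
              msup (ℓ + 1) k |cf|⁻¹ (-3) (fun j (b : PBond (PV d ℓ m K hd hL) 0) => j ≤ (blkV1 hN D b).1.1)
                  (WithLp.ofLp (dcsE cf (dcE cf A) + dE cf (dsE cf A))) ≤
                5 * dP * LP * (KL * ((B₀ * C + 1) * (1 + 2 * b₁))) * (α₀ + α₁) ∧
              -- (1.62) as printed, «on Ω_j»: the pointwise forms at every fine bond read at its own level
              (∀ b : PBond (PV d ℓ m K hd hL) 0,
                |WithLp.ofLp A b| ≤ 5 * dP * LP * (KL * ((B₀ * C + 1) * (1 + 2 * b₁))) * (α₀ + α₁) *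
                  (((geomT D).len (blkV1 hN D b) * |cf|⁻¹) ^ 1)⁻¹) ∧
              (∀ (ν : Fin (d + 1)) (b : PBond (PV d ℓ m K hd hL) 0),
                |Dop ν (WithLp.ofLp A) b| ≤ 5 * dP * LP * (KL * ((B₀ * C + 1) * (1 + 2 * b₁))) * (α₀ + α₁) *
                  (((geomT D).len (blkV1 hN D b) * |cf|⁻¹) ^ 2)⁻¹) ∧
              (∀ b : PBond (PV d ℓ m K hd hL) 0,
                |(dcsE cf (dcE cf A) + dE cf (dsE cf A)) b| ≤ 5 * dP * LP * (KL * ((B₀ * C + 1) * (1 + 2 * b₁))) * (α₀ + α₁) *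
                  (((geomT D).len (blkV1 hN D b) * |cf|⁻¹) ^ 3)⁻¹) := by
  -- the (2.88) constants of `∂P∂*` on the V1 torus (p22/p21), functions of `d, ℓ`
  obtain ⟨M₃, δ₂, CDg, hM₃, hδ₂, hCDg, hDg⟩ := hasMajorant_Dg_V1 d ℓ hd hL
  -- the Lemma-2.1 engine at the rate `δ₂`, input exponent `1`
  obtain ⟨BE, NE, hBE, hNE, hE⟩ := sup347_pf_eta d ℓ hδ₂ 1
  -- Proposition 3 of the Eta file (three majorants as arguments)
  obtain ⟨B₀, N₁, hB₀, hN₁, h⟩ := prop3_multiLevelTorus_V1_pref d ℓ hσ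
  have hKΔ : 0 ≤ BE * (((d : ℝ) + 1) * CDg) := by
    have : 0 ≤ BE := by linarith
    positivity
  refine ⟨B₀, 1 + BE * (((d : ℝ) + 1) * CDg), M₃, N₁ + NE, hB₀, by linarith, hM₃, by omega, ?_⟩
  intro k Mh R hk1 hMh1 hRM1 hR2 hM3 P' hP4 D m K hN hk cf hcf w hw b₀ b₁ hb₀ hb₁ hwb C hC Dop hG hD A J B h55 h42 h56 nJ nB hnJ hnB
    hJ hB dP LP C₂ α₀ α₁ α₂ hdP hdL hα₀ hα₁ hα₂ h55s h56s hside h50 h61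
  set KL : ℝ := 1 + BE * (((d : ℝ) + 1) * CDg) with hKLdef
  have hKL1 : 1 ≤ KL := by rw [hKLdef]; linarith
  have hP1 : ∀ μ, 1 ≤ P' μ := fun μ => le_trans (by norm_num) (hP4 μ)
  have hRM1' : N₁ + 1 ≤ R * ((ℓ + 1) * Mh) := le_trans (by omega) hRM1
  have hRME : NE + 1 ≤ R * ((ℓ + 1) * Mh) := le_trans (by omega) hRM1
  have hη : 0 < |cf|⁻¹ := inv_pos.2 (abs_pos.2 hcf)
  have hB0' : 0 ≤ B₀ := by linarith
  have hLP : 0 ≤ LP := by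
    by_contra hneg
    push Not at hneg
    nlinarith
  -- the constant of the Eta file and its weakening to this file's
  set B' : ℝ := (B₀ * C + 1) * (1 + 2 * b₁) with hB'def
  have hB'0 : 0 ≤ B' := by rw [hB'def]; positivity
  set V : ℝ := 5 * dP * LP * B' * (α₀ + α₁) with hVdef
  have hV0 : 0 ≤ V := by rw [hVdef]; positivity
  have hVK : V ≤ KL * V := le_mul_of_one_le_left hV0 hKL1
  have hKV : 5 * dP * LP * (KL * B') * (α₀ + α₁) = KL * V := by rw [hVdef]; ring
  -- the side condition of the Eta file from this file's (`K_L ≥ 1`)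
  have hside' : 36 * dP * B' * α₂ ≤ 1 / 2 := by
    have hx : 0 ≤ 36 * dP * B' * α₂ := by positivity
    have h1 := mul_le_mul_of_nonneg_left hKL1 hx
    have e : 36 * dP * (KL * B') * α₂ = 36 * dP * B' * α₂ * KL := by ring
    rw [mul_one] at h1
    linarith [h1, hside, e]
  -- slot 3 of the Eta file fed with `Lop := 0` (its `Δ`-member conclusions are then void and discarded)
  have hLap0 : HasMajorant (g := geomT D) (blkV1 hN D)
      ((0 : Module.End ℝ (PBond (PV d ℓ m K hd hL) 0 → ℝ)) ∘ₗ onFun (GE (domT hN D hk) hcf hw))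
      (fun y y' => C * Real.exp (-(σ * (geomT D).dist y y'))) := by
    rw [LinearMap.zero_comp]
    exact hasMajorant_mono (g := geomT D) (blkV1 hN D) (hasMajorant_zero (g := geomT D) (blkV1 hN D))
      fun y y' => by positivity
  obtain ⟨f1, f2, c3, -, p5, p6, -⟩ := h k Mh R hMh1 hRM1' P' hP1 D m K hd hL hN hk cf hcf w hw b₀ b₁ hb₀ hb₁ hwb C hC Dop 0 hG hD
    hLap0 A J B h55 h42 h56 nJ nB hnJ hnB hJ hB dP LP C₂ α₀ α₁ α₂ hdP hdL hα₀ hα₁ hα₂ h55s h56s hside' h50 h61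
  -- THE `Δ`-MEMBER BY §3's ROUTE: `ΔA = J + ∂(1 − R)∂*A`, (2.88) for `∂(1 − R)∂*`, applied to the pointwise `|A|`-bound `p5`
  have hT := hDg m K hN D hk hk1 hMh1 hP4 hR2 hM3 hcf
  have hT' : HasMajorant (g := geomT D) (blkV1 hN D) (onFun (dE cf ∘ₗ (LinearMap.id - RE (domT hN D hk) cf) ∘ₗ dsE cf))
      (fun y y' => (((d : ℝ) + 1) * CDg) * (((geomT D).len y * |cf|⁻¹) ^ 2)⁻¹ * Real.exp (-(δ₂ * (geomT D).dist y y'))) := by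
    refine hasMajorant_mono (g := geomT D) (blkV1 hN D) hT fun y y' => le_of_eq ?_
    have hl : (geomT D).len y ≠ 0 := (lenT_pos D y).ne'
    have hsq : ((geomT D).len y * |cf|⁻¹) ^ 2 = (geomT D).len y ^ 2 / cf ^ 2 := by
      rw [mul_pow, inv_pow, sq_abs, div_eq_mul_inv]
    rw [hsq, inv_div]
    field_simp
  have hpf : ∀ y : ↥(bset D.toDomains), 0 ≤ (((geomT D).len y * |cf|⁻¹) ^ 2)⁻¹ := fun y =>
    inv_nonneg.2 (pow_nonneg (mul_nonneg (lenT_pos D y).le hη.le) 2)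
  have hΔ := hodge_apply_eq_of_solution (domT hN D hk) cf A J h55 h42
  have mL : ∀ b : PBond (PV d ℓ m K hd hL) 0,
      |(dcsE cf (dcE cf A) + dE cf (dsE cf A)) b| ≤ KL * V * (((geomT D).len (blkV1 hN D b) * |cf|⁻¹) ^ 3)⁻¹ := by
    intro b
    have hPd := hE k Mh R hMh1 hRME P' hP1 D |cf|⁻¹ hη (fun y => (((geomT D).len y * |cf|⁻¹) ^ 2)⁻¹) hpf _ (blkV1 hN D)
      (onFun (dE cf ∘ₗ (LinearMap.id - RE (domT hN D hk) cf) ∘ₗ dsE cf)) (((d : ℝ) + 1) * CDg) (by positivity) hT'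
      (WithLp.ofLp A) V hV0 p5 b
    rw [onFun_apply, WithLp.toLp_ofLp] at hPd
    have hΔb : (dcsE cf (dcE cf A) + dE cf (dsE cf A)) b =
        J b + ((dE cf ∘ₗ (LinearMap.id - RE (domT hN D hk) cf) ∘ₗ dsE cf) A) b := by
      rw [hΔ]; rfl
    rw [hΔb]
    refine (abs_add_le _ _).trans ?_
    have hq : 0 ≤ (((geomT D).len (blkV1 hN D b) * |cf|⁻¹) ^ 3)⁻¹ :=
      inv_nonneg.2 (pow_nonneg (mul_nonneg (lenT_pos D _).le hη.le) 3)
    have h3 : (((geomT D).len (blkV1 hN D b) * |cf|⁻¹) ^ 2)⁻¹ * (((geomT D).len (blkV1 hN D b) * |cf|⁻¹) ^ 1)⁻¹ =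
        (((geomT D).len (blkV1 hN D b) * |cf|⁻¹) ^ 3)⁻¹ := by
      rw [← mul_inv, ← pow_add]
    have hJb : |J b| ≤ V * (((geomT D).len (blkV1 hN D b) * |cf|⁻¹) ^ 3)⁻¹ :=
      (hJ b).trans (mul_le_mul_of_nonneg_right c3 hq)
    have hPd' : |((dE cf ∘ₗ (LinearMap.id - RE (domT hN D hk) cf) ∘ₗ dsE cf) A) b| ≤
        BE * (((d : ℝ) + 1) * CDg) * V * (((geomT D).len (blkV1 hN D b) * |cf|⁻¹) ^ 3)⁻¹ := by
      refine hPd.trans (le_of_eq ?_)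
      rw [← h3]; ring
    have e : KL * V * (((geomT D).len (blkV1 hN D b) * |cf|⁻¹) ^ 3)⁻¹ =
        V * (((geomT D).len (blkV1 hN D b) * |cf|⁻¹) ^ 3)⁻¹ +
          BE * (((d : ℝ) + 1) * CDg) * V * (((geomT D).len (blkV1 hN D b) * |cf|⁻¹) ^ 3)⁻¹ := by
      rw [hKLdef]; ring
    rw [e]
    exact add_le_add hJb hPd'
  have e3 : (-3 : ℝ) = -((3 : ℕ) : ℝ) := by norm_num
  have hKV0 : 0 ≤ KL * V := mul_nonneg (by linarith) hV0
  have mL' : ∀ b : PBond (PV d ℓ m K hd hL) 0,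
      |(WithLp.ofLp (dcsE cf (dcE cf A) + dE cf (dsE cf A))) b| ≤ KL * V * (((geomT D).len (blkV1 hN D b) * |cf|⁻¹) ^ 3)⁻¹ :=
    fun b => mL b
  have h59l : msup (ℓ + 1) k |cf|⁻¹ (-3) (fun j (b : PBond (PV d ℓ m K hd hL) 0) => j ≤ (blkV1 hN D b).1.1)
      (WithLp.ofLp (dcsE cf (dcE cf A) + dE cf (dsE cf A))) ≤ KL * V := by
    rw [e3]; exact msup_le_of_pointwise_blk_eta D (blkV1 hN D) 3 hη hKV0 mL'
  -- assemble: the other members weakened by `K_L ≥ 1`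
  refine ⟨?_, ?_, ?_, ?_, fun b => ?_, fun ν b => ?_, fun b => ?_⟩
  · rw [hKV]; exact f1.trans hVK
  · rw [hKV]; exact f2.trans hVK
  · rw [hKV]; exact c3.trans hVK
  · rw [hKV]; exact h59l
  · rw [hKV]
    have hq : 0 ≤ (((geomT D).len (blkV1 hN D b) * |cf|⁻¹) ^ 1)⁻¹ :=
      inv_nonneg.2 (pow_nonneg (mul_nonneg (lenT_pos D _).le hη.le) 1)
    exact (p5 b).trans (mul_le_mul_of_nonneg_right hVK hq)
  · rw [hKV]
    have hq : 0 ≤ (((geomT D).len (blkV1 hN D b) * |cf|⁻¹) ^ 2)⁻¹ :=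
      inv_nonneg.2 (pow_nonneg (mul_nonneg (lenT_pos D _).le hη.le) 2)
    exact (p6 ν b).trans (mul_le_mul_of_nonneg_right hVK hq)
  · rw [hKV]; exact mL b

/-! ## §5 (v1.1)  The same statement with the fourth member written for print's own `Δ^η_{U₀}` at `U₀ = 1`: the COMPONENTWISE lattice Laplacian
`(Δ^η_1A)_μ = Σ_ν ∂*_ν∂_νA_μ` ([4] (3.23) at `U = 1`), equal to `(∂*∂ + ∂∂*)A` by the flat lattice Weitzenböck identity `B8Eq12HodgeLaplacianV1.hodge_apply` -/

/-- **PROPOSITION 3 AT `U₀ = 1` ON THE `k`-LEVEL V1 TORUS, FOURTH MEMBER = PRINT'S `|Δ^η_{U₀}A|₍₋₃₎` WITH `Δ^η_{U₀}|_{U₀=1}` THE COMPONENTWISE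
LAPLACIAN** — p. 86 *"|A|₍₋₁₎, |∇^η_{U₀}A|₍₋₂₎, |D^{η*}_{U₀}D^η_{U₀}A|₍₋₃₎, |Δ^η_{U₀}A|₍₋₃₎ ≦ B₀(|J|₍₋₃₎ + |B₁|) (1.59)"*, p. 83 *"|D^{η*}_{U₀}D^η_{U₀}A|,
|Δ^η_{U₀}A| < B₁(α₀ + α₁)(L^jη)⁻³ on Ω_j, j = 0, 1, …, k. (1.39)"*, with [4] (3.23) p. 394 *"Δ^η_U = D^{η*}_U D^η_U = Σ_{μ=1}^{d} D^{η*}_{U,μ}D^η_{U,μ}"* acting on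
each component `A_μ` ([B5] (1.21) «Δ is η-lattice Laplace operator for scalar functions»): at `U₀ = 1`, `D^η_{1,ν} = ∂_ν`, `D^{η*}_{1,ν} = ∂*_ν` and
`(Δ^η_1A)_μ(x) = Σ_ν c′²(2A_μ(x) − A_μ(x + e_ν) − A_μ(x − e_ν))` = `LatticeFieldCalculus.laplace c′ (fun z => A⟨z, μ⟩) x`
(`B8Eq12HodgeLaplacianV1.sum_covDAdj_covD_one`).  THE STATEMENT: `prop3_multiLevelTorus_V1_pref_lap` VERBATIM except that the fourth `msup` member
and the third pointwise member are stated for the bond field `b ↦ (ΔA_{μ(b)})(x(b))` instead of `(∂*∂ + ∂∂*)A` — the two bond fields are EQUAL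
(`B8Eq12HodgeLaplacianV1.ofLp_hodge`, [B5] (1.69) «Δ = ∂*∂ + ∂∂*»), so this is a restatement of §4 in print's letters, not a new estimate; same
constants `B₀′ = K_L(B₀C + 1)(1 + 2b₁)`, same thresholds, same hypotheses (slots 1–2 as arguments).
[cite: Balaban1985RegularSpaces, Prop. 3 p.87, (1.59) p.86, (1.39) p.83; Balaban1985BackgroundPropagators, (3.23) p.394, Theorem 3.3 p.399; Balaban1984PropagatorsI, (1.69) p.29, (1.21) p.21; Balaban1984PropagatorsII, Prop. 2.6 (2.136) p.247, (2.19) p.226, (2.88) p.238] -/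
theorem prop3_multiLevelTorus_V1_pref_vecLap (d ℓ : ℕ) (hd : 1 ≤ d + 1) (hL : Odd (ℓ + 1) ∧ 1 < ℓ + 1) {σ : ℝ} (hσ : 0 < σ) :
    ∃ B₀ KL M₃ : ℝ, ∃ N₁ : ℕ, 1 ≤ B₀ ∧ 1 ≤ KL ∧ 0 < M₃ ∧ 0 < N₁ ∧
      ∀ (k Mh R : ℕ), 1 ≤ k → 1 ≤ Mh → N₁ + 1 ≤ R * ((ℓ + 1) * Mh) → 2 * (ℓ + 1) ≤ R → M₃ ≤ ((ℓ : ℝ) + 1) * Mh →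
      ∀ (P' : Fin (d + 1) → ℕ) (_hP : ∀ μ, 4 ≤ P' μ) (D : B6MultiLevelTorusOperatorL0.TDomains d ℓ Mh k P' R)
        (m K : ℕ) (hN : ∀ μ, N0 ℓ Mh k P' μ = (PV d ℓ m K hd hL).sitesPerDir 0) (hk : k ≤ m + K)
        (cf : ℝ) (hcf : cf ≠ 0) (w : BondIdx (domT hN D hk) → ℝ) (hw : ∀ i, 0 < w i)
        (b₀ b₁ : ℝ) (_hb₀ : 0 ≤ b₀) (_hb₁ : 0 ≤ b₁) (_hwb : GlobalBand b₀ b₁ cf w) (C : ℝ) (_hC : 0 ≤ C)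
        (Dop : Fin (d + 1) → Module.End ℝ (PBond (PV d ℓ m K hd hL) 0 → ℝ)),
        HasMajorant (g := geomT D) (blkV1 hN D) (onFun (GE (domT hN D hk) hcf hw))
          (fun y y' => C * pref cf y * Real.exp (-(σ * (geomT D).dist y y'))) →
        (∀ ν, HasMajorant (g := geomT D) (blkV1 hN D) (Dop ν ∘ₗ onFun (GE (domT hN D hk) hcf hw))
          (fun y y' => C * ((geomT D).len y * |cf|⁻¹) * Real.exp (-(σ * (geomT D).dist y y')))) →
        ∀ (A J : BondSpace (PV d ℓ m K hd hL)) (B : BondIdxSpace (domT hN D hk)),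
          dcsE cf (dcE cf A) = J → RE (domT hN D hk) cf (dsE cf A) = 0 → QE (domT hN D hk) A = B →
          ∀ (nJ nB : ℝ), 0 ≤ nJ → 0 ≤ nB →
            (∀ b, |J b| ≤ nJ * (((geomT D).len (blkV1 hN D b) * |cf|⁻¹) ^ 3)⁻¹) →
            (∀ i, |B i| ≤ nB * (((ℓ : ℝ) + 1) ^ (i.1.1 : ℕ) * |cf|⁻¹)⁻¹) →
          ∀ (dP LP C₂ α₀ α₁ α₂ : ℝ), 0 ≤ dP → 1 ≤ dP * LP → 0 ≤ α₀ → 0 ≤ α₁ → 0 ≤ α₂ →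
            nJ ≤ 2 * α₀ + 36 * dP * α₂ *
                msup (ℓ + 1) k |cf|⁻¹ (-2) (fun j (p : Fin (d + 1) × PBond (PV d ℓ m K hd hL) 0) => j ≤ (blkV1 hN D p.2).1.1)
                  (fun p : Fin (d + 1) × PBond (PV d ℓ m K hd hL) 0 => Dop p.1 (WithLp.ofLp A) p.2) +
              50 * dP * α₂ ^ 3 + 10 * dP * α₀ * α₂ →
            nB ≤ 2 * dP * LP * α₁ + C₂ * α₂ ^ 2 →
            36 * dP * (KL * ((B₀ * C + 1) * (1 + 2 * b₁))) * α₂ ≤ 1 / 2 → 50 * dP * α₂ ≤ 1 →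
            2 * α₂ ^ 2 + 20 * dP * α₀ * α₂ + 2 * C₂ * α₂ ^ 2 ≤ α₀ + α₁ →
            msup (ℓ + 1) k |cf|⁻¹ (-1) (fun j (b : PBond (PV d ℓ m K hd hL) 0) => j ≤ (blkV1 hN D b).1.1) (WithLp.ofLp A) ≤
                5 * dP * LP * (KL * ((B₀ * C + 1) * (1 + 2 * b₁))) * (α₀ + α₁) ∧
              msup (ℓ + 1) k |cf|⁻¹ (-2) (fun j (p : Fin (d + 1) × PBond (PV d ℓ m K hd hL) 0) => j ≤ (blkV1 hN D p.2).1.1)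
                  (fun p : Fin (d + 1) × PBond (PV d ℓ m K hd hL) 0 => Dop p.1 (WithLp.ofLp A) p.2) ≤
                5 * dP * LP * (KL * ((B₀ * C + 1) * (1 + 2 * b₁))) * (α₀ + α₁) ∧
              nJ ≤ 5 * dP * LP * (KL * ((B₀ * C + 1) * (1 + 2 * b₁))) * (α₀ + α₁) ∧
              -- «|Δ^η_{U₀}A|₍₋₃₎» at U₀ = 1: the componentwise Laplacian of A, read in the p. 86 norm
              msup (ℓ + 1) k |cf|⁻¹ (-3) (fun j (b : PBond (PV d ℓ m K hd hL) 0) => j ≤ (blkV1 hN D b).1.1)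
                  (fun b : PBond (PV d ℓ m K hd hL) 0 => laplace cf (fun z => A ⟨z, b.dir⟩) b.src) ≤
                5 * dP * LP * (KL * ((B₀ * C + 1) * (1 + 2 * b₁))) * (α₀ + α₁) ∧
              (∀ b : PBond (PV d ℓ m K hd hL) 0,
                |WithLp.ofLp A b| ≤ 5 * dP * LP * (KL * ((B₀ * C + 1) * (1 + 2 * b₁))) * (α₀ + α₁) *
                  (((geomT D).len (blkV1 hN D b) * |cf|⁻¹) ^ 1)⁻¹) ∧
              (∀ (ν : Fin (d + 1)) (b : PBond (PV d ℓ m K hd hL) 0),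
                |Dop ν (WithLp.ofLp A) b| ≤ 5 * dP * LP * (KL * ((B₀ * C + 1) * (1 + 2 * b₁))) * (α₀ + α₁) *
                  (((geomT D).len (blkV1 hN D b) * |cf|⁻¹) ^ 2)⁻¹) ∧
              -- «|Δ^η_{U₀}A| < … (L^jη)⁻³ on Ω_j» (1.39)/(1.62) at U₀ = 1, at every fine bond read at its own level
              (∀ b : PBond (PV d ℓ m K hd hL) 0,
                |laplace cf (fun z => A ⟨z, b.dir⟩) b.src| ≤ 5 * dP * LP * (KL * ((B₀ * C + 1) * (1 + 2 * b₁))) * (α₀ + α₁) *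
                  (((geomT D).len (blkV1 hN D b) * |cf|⁻¹) ^ 3)⁻¹) := by
  obtain ⟨B₀, KL, M₃, N₁, hB₀, hKL, hM₃, hN₁, h⟩ := prop3_multiLevelTorus_V1_pref_lap d ℓ hd hL hσ
  refine ⟨B₀, KL, M₃, N₁, hB₀, hKL, hM₃, hN₁, ?_⟩
  intro k Mh R hk1 hMh1 hRM1 hR2 hM3 P' hP4 D m K hN hk cf hcf w hw b₀ b₁ hb₀ hb₁ hwb C hC Dop hG hD A J B h55 h42 h56 nJ nB hnJ hnB
    hJ hB dP LP C₂ α₀ α₁ α₂ hdP hdL hα₀ hα₁ hα₂ h55s h56s hside h50 h61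
  obtain ⟨f1, f2, c3, f4, p5, p6, p7⟩ := h k Mh R hk1 hMh1 hRM1 hR2 hM3 P' hP4 D m K hN hk cf hcf w hw b₀ b₁ hb₀ hb₁ hwb C hC Dop hG hD A J B
    h55 h42 h56 nJ nB hnJ hnB hJ hB dP LP C₂ α₀ α₁ α₂ hdP hdL hα₀ hα₁ hα₂ h55s h56s hside h50 h61
  rw [ofLp_hodge] at f4
  refine ⟨f1, f2, c3, f4, p5, p6, fun b => ?_⟩
  rw [← hodge_apply]
  exact p7 b

end Prop3

end

end Literature.MathematicalPhysics.QuantumFieldTheory.Balaban1983to89.B8Prop3MultiLevelTorusLapL0
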